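import Summits.CriticalPhenomena.PercolationContinuityZ3.Theorems.Transplant.PlanarCells2Levels
import HarnessLib

/-!
# Two-unit planar cells, supplement: the STAIRCASE LEVEL — a monotone 1-Lipschitz reparametrisation of the planar level along each axis
# under which the shifted face rows `5r_a + 10 s_a j − 1` of BOTH axes sit at the common integer levels `2j` (layer L3′ of route D″)

builds on p205010 (kernel theorem, internal audit signed; external expert review pending) — nothing in this file uses p205010.
Lane `prim-bschramm-*`, seat `prim-bschramm-p2` (gen 7; D″ order of battle `DPRIME-SCOPE.md` §2 L3′, p3 addendum K); helper file
(`--supports stmt-CriticalPhenomena-4575 --as helper`).  Pure `ℤ` arithmetic over hp-8's `PCells2`; nothing here edits `PlanarCells2*`.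

WHY.  The generic Kozma–Nitzan engine reads levels through `KNCells.LevelData` (`lev : A → Site 2 → MDir → V → ℤ`, face levels `L : ℕ → ℤ`,
cube bound `ℓQ : ℤ`) and `LevelGeom`; the face levels `L j` carry NO direction.  With one unit the cell geometry of record takes `lev` = the planar
level `σ (t_a − cen v_a)` and `L j = 5r + 10 s j − 1` (`Skel.levelDataS`).  With TWO units the planar face rows are `5 r_a + 10 s_a j − 1`, different on
the two axes, so no direction-free `L` fits the planar level itself.  The cure that keeps the whole L2 engine untouched: feed the engine the planar
level COMPOSED with a monotone map `f_a : ℤ → ℤ` of increments `0/1` (so `lev` stays `1`-Lipschitz along edges) that climbs by exactly `2` per stub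
level, with `f_a (5r_a + 10 s_a j − 2, − 1, + 0) = (2j − 1, 2j, 2j + 1)` and a plateau at `2j + 1` up to `5 r_a + 10 s_a (j+1) − 2`: then `L j := 2j`,
`ℓQ := 1` serve both axes, `lev ≤ L j ⇔ planar level ≤ 5r_a + 10 s_a j − 1`, `lev = L j ⇔ planar level = 5r_a + 10s_a j − 1`, and every clause of
`LevelGeom` ports verbatim (file `SkelPhiCellsConcGLevels`).
* `PCells2.stairFun m x := 2 (x / m) − 1 + min (x % m) 2` (block length `m ≥ 3`): `stairFun_succ` (increments `0/1`), `stairFun_mono`,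
  `stairFun_le_add`, the block values `stairFun_mul / _mul_add_one / _mul_add_two`;
* `PCells2.stairLev P a ℓ := stairFun (10 s_a) (ℓ − 5 r_a + 2)`: `stairLev_mono`, `stairLev_le_add_one` (`|ℓ' − ℓ| ≤ 1 ⇒ f ℓ' ≤ f ℓ + 1`), the face
  values `stairLev_faceRow = 2j`, `stairLev_face = 2j + 1`, `stairLev_faceRow_pred = 2j − 1`, `stairLev_base_succ` (`f (5r_a + 1) = 1`), and the
  readings `le_faceRow_of_stairLev_le`, `eq_faceRow_of_stairLev_eq`, `stairLev_le_one_of_le`, `stairLev_ge_of_face_le`.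
[cite: KozmaNitzan2024, §4 p. 26 (H^j_{v,x}), p. 30 (F^j_{v,x}), p. 31 (Step IV: levels along the corridor)]
-/

namespace Summit.CriticalPhenomena.PercolationContinuityZ3.Theorems

namespace Transplant

namespace PCells2

/-! ## §1 The staircase function of block length `m` -/

/-- **The staircase function** of block length `m`: on the block `[m q, m q + m − 1]` it takes the values `2q − 1, 2q, 2q + 1, 2q + 1, …`.
[this work] -/
def stairFun (m x : ℤ) : ℤ := 2 * (x / m) - 1 + min (x % m) 2

/-- Block value at `m q`: `2q − 1`. [folklore] -/
theorem stairFun_mul {m : ℤ} (hm : 3 ≤ m) (q : ℤ) : stairFun m (m * q) = 2 * q - 1 := by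
  have h := (Int.ediv_emod_unique (a := m * q) (b := m) (r := 0) (q := q) (by omega)).2 ⟨by ring, le_rfl, by omega⟩
  rw [stairFun, h.1, h.2]; simp

/-- Block value at `m q + 1`: `2q`. [folklore] -/
theorem stairFun_mul_add_one {m : ℤ} (hm : 3 ≤ m) (q : ℤ) : stairFun m (m * q + 1) = 2 * q := by
  have h := (Int.ediv_emod_unique (a := m * q + 1) (b := m) (r := 1) (q := q) (by omega)).2 ⟨by ring, by omega, by omega⟩
  rw [stairFun, h.1, h.2, min_eq_left (by norm_num)]; ring

/-- Block value at `m q + 2`: `2q + 1`. [folklore] -/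
theorem stairFun_mul_add_two {m : ℤ} (hm : 3 ≤ m) (q : ℤ) : stairFun m (m * q + 2) = 2 * q + 1 := by
  have h := (Int.ediv_emod_unique (a := m * q + 2) (b := m) (r := 2) (q := q) (by omega)).2 ⟨by ring, by omega, by omega⟩
  rw [stairFun, h.1, h.2, min_self]; ring

/-- Block value at `m q + ρ`, `2 ≤ ρ < m`: `2q + 1` (the plateau). [folklore] -/
theorem stairFun_mul_add_of_two_le {m : ℤ} (hm : 3 ≤ m) (q : ℤ) {ρ : ℤ} (h2 : 2 ≤ ρ) (hρ : ρ < m) :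
    stairFun m (m * q + ρ) = 2 * q + 1 := by
  have h := (Int.ediv_emod_unique (a := m * q + ρ) (b := m) (r := ρ) (q := q) (by omega)).2 ⟨by ring, by omega, hρ⟩
  rw [stairFun, h.1, h.2, min_eq_right h2]; ring

/-- **Increments are `0` or `1`.** [folklore] -/
theorem stairFun_succ {m : ℤ} (hm : 3 ≤ m) (x : ℤ) : stairFun m x ≤ stairFun m (x + 1) ∧ stairFun m (x + 1) ≤ stairFun m x + 1 := by
  have hm0 : 0 < m := by omega
  set q := x / m with hq
  set ρ := x % m with hρ
  have hx : ρ + m * q = x := Int.emod_add_mul_ediv x m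
  have hρ0 : 0 ≤ ρ := Int.emod_nonneg _ (by omega)
  have hρm : ρ < m := Int.emod_lt_of_pos _ hm0
  have hfx : stairFun m x = 2 * q - 1 + min ρ 2 := rfl
  by_cases hlast : ρ + 1 < m
  · -- same block: the remainder grows by one
    have h := (Int.ediv_emod_unique (a := x + 1) (b := m) (r := ρ + 1) (q := q) hm0).2 ⟨by rw [← hx]; ring, by omega, hlast⟩
    have hfx1 : stairFun m (x + 1) = 2 * q - 1 + min (ρ + 1) 2 := by rw [stairFun, h.1, h.2]
    rw [hfx, hfx1]
    rcases le_total ρ 2 with h2 | h2 <;> rcases le_total (ρ + 1) 2 with h3 | h3 <;>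
      simp only [min_eq_left, min_eq_right, h2, h3] <;> omega
  · -- last point of the block: the next block starts at the same value
    have hρe : ρ = m - 1 := by omega
    have h := (Int.ediv_emod_unique (a := x + 1) (b := m) (r := 0) (q := q + 1) hm0).2 ⟨by rw [← hx, hρe]; ring, le_rfl, hm0⟩
    have hfx1 : stairFun m (x + 1) = 2 * (q + 1) - 1 + min 0 2 := by rw [stairFun, h.1, h.2]
    rw [hfx, hfx1, min_eq_right (by omega : (2 : ℤ) ≤ ρ), min_eq_left (by norm_num : (0 : ℤ) ≤ 2)]
    omega

/-- Along `n` unit steps the staircase grows, by at most `n`. [folklore] -/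
theorem stairFun_add_nat {m : ℤ} (hm : 3 ≤ m) (x : ℤ) (n : ℕ) :
    stairFun m x ≤ stairFun m (x + n) ∧ stairFun m (x + n) ≤ stairFun m x + n := by
  induction n with
  | zero => simp
  | succ n ih =>
    have h := stairFun_succ hm (x + n)
    push_cast
    rw [← add_assoc]
    exact ⟨ih.1.trans h.1, by linarith [h.2, ih.2]⟩

/-- **The staircase is monotone.** [folklore] -/
theorem stairFun_mono {m : ℤ} (hm : 3 ≤ m) {x y : ℤ} (h : x ≤ y) : stairFun m x ≤ stairFun m y := by
  obtain ⟨n, rfl⟩ := Int.le.dest h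
  exact (stairFun_add_nat hm x n).1

/-- **The staircase is `1`-Lipschitz**: `y ≤ x + 1 ⇒ f y ≤ f x + 1`. [folklore] -/
theorem stairFun_le_add_one {m : ℤ} (hm : 3 ≤ m) {x y : ℤ} (h : y ≤ x + 1) : stairFun m y ≤ stairFun m x + 1 :=
  (stairFun_mono hm h).trans (by simpa using (stairFun_add_nat hm x 1).2)

/-! ## §2 The staircase level of the two-unit cells along axis `a` -/

variable (P : PCells2)

/-- **The staircase level** along axis `a`: the staircase of block length `10 s_a` read at `ℓ − 5 r_a + 2`, so that the shifted face row
`5 r_a + 10 s_a j − 1` sits at `2j`, the face `5 r_a + 10 s_a j` at `2j + 1`, and the base rows `≤ 5 r_a + 1` at `≤ 1`. [this work] -/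
def stairLev (a : Fin 2) (ℓ : ℤ) : ℤ := stairFun (10 * (P.s a : ℤ)) (ℓ - 5 * (P.r a : ℤ) + 2)

/-- `10 s_a ≥ 3`. [folklore] -/
theorem three_le_ten_mul_s (a : Fin 2) : (3 : ℤ) ≤ 10 * (P.s a : ℤ) := by have := P.hs a; omega

/-- The staircase level is monotone in the planar level. [folklore] -/
theorem stairLev_mono (a : Fin 2) {ℓ ℓ' : ℤ} (h : ℓ ≤ ℓ') : P.stairLev a ℓ ≤ P.stairLev a ℓ' :=
  stairFun_mono (P.three_le_ten_mul_s a) (by omega)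

/-- **The staircase level is `1`-Lipschitz**: `ℓ' ≤ ℓ + 1 ⇒ f ℓ' ≤ f ℓ + 1`. [folklore] -/
theorem stairLev_le_add_one (a : Fin 2) {ℓ ℓ' : ℤ} (h : ℓ' ≤ ℓ + 1) : P.stairLev a ℓ' ≤ P.stairLev a ℓ + 1 :=
  stairFun_le_add_one (P.three_le_ten_mul_s a) (by omega)

/-- **The shifted face row `5 r_a + 10 s_a j − 1` sits at staircase level `2j`.** [this work] -/
theorem stairLev_faceRow (a : Fin 2) (j : ℕ) : P.stairLev a (5 * (P.r a : ℤ) + 10 * (P.s a : ℤ) * j - 1) = 2 * (j : ℤ) := by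
  rw [stairLev, show 5 * (P.r a : ℤ) + 10 * (P.s a : ℤ) * j - 1 - 5 * (P.r a : ℤ) + 2 = 10 * (P.s a : ℤ) * j + 1 by ring]
  exact stairFun_mul_add_one (P.three_le_ten_mul_s a) j

/-- The face `5 r_a + 10 s_a j` sits at staircase level `2j + 1`. [this work] -/
theorem stairLev_face (a : Fin 2) (j : ℕ) : P.stairLev a (5 * (P.r a : ℤ) + 10 * (P.s a : ℤ) * j) = 2 * (j : ℤ) + 1 := by
  rw [stairLev, show 5 * (P.r a : ℤ) + 10 * (P.s a : ℤ) * j - 5 * (P.r a : ℤ) + 2 = 10 * (P.s a : ℤ) * j + 2 by ring]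
  exact stairFun_mul_add_two (P.three_le_ten_mul_s a) j

/-- The row `5 r_a + 10 s_a j − 2` sits at staircase level `2j − 1`. [this work] -/
theorem stairLev_faceRow_pred (a : Fin 2) (j : ℕ) : P.stairLev a (5 * (P.r a : ℤ) + 10 * (P.s a : ℤ) * j - 2) = 2 * (j : ℤ) - 1 := by
  rw [stairLev, show 5 * (P.r a : ℤ) + 10 * (P.s a : ℤ) * j - 2 - 5 * (P.r a : ℤ) + 2 = 10 * (P.s a : ℤ) * j by ring]
  exact stairFun_mul (P.three_le_ten_mul_s a) j

/-- The row `5 r_a + 1` (top of the cube plus one) sits at staircase level `1`. [this work] -/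
theorem stairLev_base_succ (a : Fin 2) : P.stairLev a (5 * (P.r a : ℤ) + 1) = 1 := by
  rw [stairLev, show 5 * (P.r a : ℤ) + 1 - 5 * (P.r a : ℤ) + 2 = 10 * (P.s a : ℤ) * 0 + 3 by ring]
  rw [stairFun_mul_add_of_two_le (P.three_le_ten_mul_s a) 0 (by norm_num) (by have := P.hs a; omega)]; ring

/-- **Reading `lev ≤ L j`**: staircase level `≤ 2j` means planar level `≤ 5 r_a + 10 s_a j − 1`. [this work] -/
theorem le_faceRow_of_stairLev_le (a : Fin 2) {ℓ : ℤ} {j : ℕ} (h : P.stairLev a ℓ ≤ 2 * (j : ℤ)) :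
    ℓ ≤ 5 * (P.r a : ℤ) + 10 * (P.s a : ℤ) * j - 1 := by
  by_contra hlt
  have hmono := P.stairLev_mono a (show 5 * (P.r a : ℤ) + 10 * (P.s a : ℤ) * j ≤ ℓ by omega)
  rw [stairLev_face] at hmono
  omega

/-- **Reading `lev = L j`**: staircase level `= 2j` means planar level `= 5 r_a + 10 s_a j − 1`. [this work] -/
theorem eq_faceRow_of_stairLev_eq (a : Fin 2) {ℓ : ℤ} {j : ℕ} (h : P.stairLev a ℓ = 2 * (j : ℤ)) :
    ℓ = 5 * (P.r a : ℤ) + 10 * (P.s a : ℤ) * j - 1 := by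
  have h1 := P.le_faceRow_of_stairLev_le a h.le
  by_contra hne
  have hmono := P.stairLev_mono a (show ℓ ≤ 5 * (P.r a : ℤ) + 10 * (P.s a : ℤ) * j - 2 by omega)
  rw [stairLev_faceRow_pred] at hmono
  omega

/-- **Reading the cube bound**: planar level `≤ 5 r_a + 1` means staircase level `≤ 1`. [this work] -/
theorem stairLev_le_one_of_le (a : Fin 2) {ℓ : ℤ} (h : ℓ ≤ 5 * (P.r a : ℤ) + 1) : P.stairLev a ℓ ≤ 1 := by
  have := P.stairLev_mono a h; rwa [stairLev_base_succ] at this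

/-- Planar level `≥ 5 r_a + 10 s_a j` means staircase level `≥ 2j + 1`. [this work] -/
theorem stairLev_ge_of_face_le (a : Fin 2) {ℓ : ℤ} {j : ℕ} (h : 5 * (P.r a : ℤ) + 10 * (P.s a : ℤ) * j ≤ ℓ) :
    2 * (j : ℤ) + 1 ≤ P.stairLev a ℓ := by
  have := P.stairLev_mono a h; rwa [stairLev_face] at this

/-- Planar level `≥ 5 r_a + 2` means staircase level `≥ 1` — and planar level `≤ 5 r_a + 1` iff staircase level `≤ 1` fails above: the
contrapositive reading `stairLev ≤ 1 ⇒ ℓ ≤ 5 r_a + 10 s_a − 1` is `le_faceRow_of_stairLev_le` at `j = 1`… the form used by `lev_Hfull` is this one: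
staircase level `≥ 2` forces planar level `≥ 5 r_a + 2`. [this work] -/
theorem base_add_two_le_of_two_le_stairLev (a : Fin 2) {ℓ : ℤ} (h : 2 ≤ P.stairLev a ℓ) : 5 * (P.r a : ℤ) + 2 ≤ ℓ := by
  by_contra hlt
  have := P.stairLev_le_one_of_le a (show ℓ ≤ 5 * (P.r a : ℤ) + 1 by omega)
  omega

end PCells2

end Transplant

end Summit.CriticalPhenomena.PercolationContinuityZ3.Theorems
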